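import Literature.MathematicalPhysics.QuantumFieldTheory.Balaban1983to89.B5QGGQ145Bounds
import Literature.MathematicalPhysics.QuantumFieldTheory.Balaban1983to89.B5Prop11Leaves

/-!
# `Balaban1983to89.B5QGGQ145Gamma1` — B5 p. 25 «0 < Q′_kG′_k²Q′_k* ≦ a⁻²» and p. 26 «γ₀ dependent only on d,
γ₁ = a⁻²» as KERNEL THEOREMS for every `0 < a ≤ 1`

T. Bałaban, *Propagators and renormalization transformations for lattice gauge theories. I*, Commun. Math. Phys.
**95**, 17–40 (1984) [Balaban1984PropagatorsI] (cell paper B5), Sect. C, pp. 25–26 [PDF 9–10].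

CITATION HEADER (lean-in-tree rule 2026-08-18).  The two printed sentences served here, verbatim (materialised text
`paper:balaban1984-cmp95-propagators-rt-i`, p0009.txt l.33–34 and p0010.txt l.3–5):
 * p. 25 [PDF 9], after (1.44): «We have bounds 0 < Q′_kG′_k²Q′_k* ≦ a⁻², and they imply the existence of the inverse
   operator and a bound from below.»
 * p. 26 [PDF 10], after (1.45): «From this representation and from the bounds (2.51), (2.52) of that paper, it
   follows that there are positive constants γ₀, γ₁, in fact γ₀ dependent only on d, γ₁ = a⁻², such that
   γ₀ ≦ Q′_kG′_k²Q′_k* ≦ γ₁.»  («that paper» = [2] = B4, Balaban1983RegularityDecay; its (2.52) does not exist,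
   (2.50)–(2.51) are meant — cell census C-B5-2.)
Here `Q′_k` is the block average from the `η = L^{-k}`-lattice to the unit lattice, `G′_k = (Δ′_a)⁻¹`,
`Δ′_a = Δ + aQ′_k*Q′_k` (p. 25), and (1.45) is the Fourier multiplier of `Q′_kG′_k²Q′_k*` on the unit torus.

WHAT THIS FILE PROVES (no carrier, no `…Printed` Prop; over the sibling modules' concrete symbols).  Write, for a real
momentum `p′ = s ∈ [−π,π]^m`, `n = L^k`, `l = 2πk′` (`k′ : Fin m → Fin n`):  `Δ = DeltaXir n 0 s` (= printed Δ(p′)),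
`Δ₀ = Delta1r 0 s`, `|u(p′+l)|² = Ur n k′ s`, `E = B4Strip.Er n a 0 s = Δ·[1 + aΣ_l |u(p′+l)|²/Δ(p′+l)]` (regrouped
denominator) and `𝒩 = B5Strip145.Ncalr n s = |u(p′)|² + Δ² Σ_{l≠0} |u(p′+l)|²/Δ(p′+l)²` (regrouped numerator), so that
(1.45) `= 𝒩/E²` (`B5Strip145.mReg`, `B5QGGQ145Bounds.ev` at the dual momenta of a torus).
 * §1–§2 THE LATTICE INEQUALITY (the audit's mechanism, elementary): on the whole Brillouin zone, every `n ≥ 1`,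
   `Δ₀(p′)|u(p′)|²/Δ(p′) + 2Δ₀(p′) ≥ 1` (`key_lattice_ineq`; from `2 − 2cos y ≥ y² − y⁴/12`, `S_ξ(y) ≤ y²`,
   the Weierstrass step `xP ≥ x + P − 1` by induction on the dimension, and Jordan's `2 − 2cos y ≥ 4y²/π²`).
 * §3 THE SCALAR HEART: with `X = Δ₀·Σ_l |u(p′+l)|²/Δ(p′+l)` one has `a²·𝒩 ≤ a²Δ²X/Δ₀² ≤ Δ²(Δ₀ + aX)²/Δ₀² = E²`
   for `0 < a ≤ 1`, using `Δ(p′+l) ≥ Δ₀(p′)` (tree `B5Prop11Leaves.Delta1r_le_DeltaXir_shift`) and the lattice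
   inequality (`gamma1_scalar`).
 * §4 THE SPECTRAL THEOREM `𝒩(p′) ≤ a⁻² E(p′)²` on `[−π,π]^m` for every `0 < a ≤ 1`, every `m`, every `n ≥ 1`
   (`Ncalr_le`), with EQUALITY at `p′ = 0` (`Ncalr_zero`, `Er_zero`; cf. `B5QGGQ145Torus.mReg_at_zero`); hence every
   eigenvalue of `Q′_kG′_k²Q′_k*` on every torus is `≤ a⁻²` (`ev_le_inv_sq`) and `= a⁻²` at zero momentum (`ev_at_zero`).
 * §5 THE COMPLEMENTARY CONSTANTS, explicit: `E ≤ π²m + a(1 + π²m/4)` (`Er_le`), hence for `0 < a ≤ 1` every eigenvalue is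
   `≥ γ₀(d) := (4/π²)^{d+1}/(π²(d+1) + 1 + π²(d+1)/4)²`, an explicit constant DEPENDING ON `d` ONLY, written out in
   every statement (`gamma0_le_ev`, `gamma0_pos`; no `def`).
 * §6 THE PRINTED SENTENCES AS OPERATOR INEQUALITIES on every finite torus `Π_μ ℤ/N_μ` (`N_μ ≥ 1`), every `n = L^k ≥ 1`,
   every `ω`, uniformly: for `0 < a ≤ 1`, `γ₀(d)·Σ|ω|² ≤ ⟨ω, Q′G′²Q′*ω⟩ ≤ a⁻²·Σ|ω|²` (`printed_bounds_small_a` — the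
   quantifier shape of the skeleton's `B5.Bounds145Printed`: γ₀ chosen before `k`, the volume, `a` and `ω`; γ₁ = a⁻²
   literally), and for the inverse operator (kernel `torusKernel145M` = `(Q′G′²Q′*)⁻¹`, `B5QGGQ145Torus`)
   `a²·Σ|ω|² ≤ ⟨ω, (Q′G′²Q′*)⁻¹ω⟩ ≤ γ₀(d)⁻¹·Σ|ω|²` (`printed_inverse_bounds_small_a` — «the existence of the inverse
   operator and a bound from below», the bound from below being `a²`).

HONEST SCOPE.  (i) The regime is `0 < a ≤ 1` — it contains the paper's own choice («we can take arbitrary a in the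
representation, e.g. a = 1, which is most convenient for bounds», p. 26 [PDF 10] l.7–9), the value the series works
with (cell census G-B5-13).  For LARGE `a` the printed value γ₁ = a⁻² is FALSE (G-B5-13: exact witness d = 2, L = 3,
k = 1, p′ = (π,0), a ≥ 302, `B5.printed_gamma1_fails`); that objection is untouched by this file and the threshold in
`a` is not located here (the proof below uses `a ≤ 1` exactly once, in `(Δ₀ + aX)² ≥ a²(Δ₀ + X)²`).  (ii) «γ₀ dependent
only on d» is certified for `a ∈ (0,1]` with the explicit (far from optimal) constant of `gamma0_le_ev`; for unbounded
`a` no `a`-independent γ₀ exists (at `p′ = 0` the multiplier equals `a⁻² → 0`).  (iii) Nothing here uses the uniform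
complex strip of (1.45) (`B5Strip145Leaves`) — the window `ev_window` of `B5QGGQ145Bounds` remains the source of the
`a`-window constants for general `0 < a₋ ≤ a ≤ a₊`; on `a ∈ (0,1]` this file sharpens the upper end of that window to
the PRINTED value `a⁻²` and makes the lower end an explicit function of `d` alone.  (iv) This certifies G-B5-13's
«TRUE at a = 1 in every tested case (numerics)» as a theorem for all `d`, `L^k`, tori and all `0 < a ≤ 1`; it is NOT
summit progress.

Tags (18 declarations, all theorems): 6 `[cite: Balaban1984PropagatorsI, …]` (the statements that ARE the printed
sentences or their spectral form: `Ncalr_le`, `ev_le_inv_sq`, `ev_at_zero`, `gamma0_le_ev`, `printed_bounds_small_a`,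
`printed_inverse_bounds_small_a`), 12 `[folklore]` (one-variable calculus, the product bound `|u|² ≥ 1 − Σp′²/12`,
the lattice inequality, order bookkeeping).  No `sorry`, no new axioms; imports `B5QGGQ145Bounds` (b05-g7) and
`B5Prop11Leaves` (b05-g2) only.  Unit `b2b-balaban-b05-g14` (PAPER SUB-CELL B05, gen 14; claim GAMMA1-SMALL-A).
Companion records: GAPS.md C-b05g14-1 (addendum to G-B5-13 / C-B5-44), DIVERGENCE.md D-b05g14.1.  Staged
byte-identically in the cell package under `HOME/lean/BalabanYm4/`.
-/

namespace Literature.MathematicalPhysics.QuantumFieldTheory.Balaban1983to89.B5QGGQ145Gamma1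

open Complex Finset ComplexConjugate
open Literature.MathematicalPhysics.QuantumFieldTheory.Balaban1983to89.B4Strip
open Literature.MathematicalPhysics.QuantumFieldTheory.Balaban1983to89.B4ContourShift
open Literature.MathematicalPhysics.QuantumFieldTheory.Balaban1983to89.B4TorusKernel
open Literature.MathematicalPhysics.QuantumFieldTheory.Balaban1983to89.B4Green244
open Literature.MathematicalPhysics.QuantumFieldTheory.Balaban1983to89.B4TorusGreen244
open Literature.MathematicalPhysics.QuantumFieldTheory.Balaban1983to89.B4TorusPositivity
open Literature.MathematicalPhysics.QuantumFieldTheory.Balaban1983to89.B5Strip145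
open Literature.MathematicalPhysics.QuantumFieldTheory.Balaban1983to89.B5Torus145Decay
open Literature.MathematicalPhysics.QuantumFieldTheory.Balaban1983to89.B5QGGQ145Torus
open Literature.MathematicalPhysics.QuantumFieldTheory.Balaban1983to89.B5QGGQ145Bounds
open Literature.MathematicalPhysics.QuantumFieldTheory.Balaban1983to89.B5Prop11Leaves
open scoped Real

noncomputable section

/-! ### §1 One-variable leaves -/

/-- fourth-order Jordan–Taylor bound `2 − 2cos y ≥ y² − y⁴/12` on `|y| ≤ π`
(`sin x ≥ x − x³/6` for `x = |y|/2 ∈ [0, π/2]`, squared). [folklore] -/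
theorem S1r_ge_taylor (y : ℝ) (hy : |y| ≤ Real.pi) : y ^ 2 - y ^ 4 / 12 ≤ S1r y := by
  rw [S1r_eq]
  have hpi4 := Real.pi_lt_four
  have key : ∀ z : ℝ, 0 ≤ z → z ≤ Real.pi → z ^ 2 - z ^ 4 / 12 ≤ 4 * Real.sin (z / 2) ^ 2 := by
    intro z hz0 hz1
    have hx0 : 0 ≤ z / 2 := by positivity
    have hx2 : z / 2 ≤ 2 := by linarith
    have h1 : z / 2 - (z / 2) ^ 3 / 6 ≤ Real.sin (z / 2) := Real.sin_ge_sub_cube hx0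
    have h2 : 0 ≤ z / 2 - (z / 2) ^ 3 / 6 := by
      have h4 : (z / 2) ^ 2 ≤ 4 := by nlinarith
      have h5 : 0 ≤ 1 - (z / 2) ^ 2 / 6 := by linarith
      have h6 : z / 2 - (z / 2) ^ 3 / 6 = (z / 2) * (1 - (z / 2) ^ 2 / 6) := by ring
      rw [h6]
      exact mul_nonneg hx0 h5
    have h3 : (z / 2 - (z / 2) ^ 3 / 6) ^ 2 ≤ Real.sin (z / 2) ^ 2 := pow_le_pow_left₀ h2 h1 2
    have h7 : 0 ≤ z ^ 6 := by positivity
    nlinarith [h3, h7]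
  rcases le_or_gt 0 y with h | h
  · exact key y h (by rwa [abs_of_nonneg h] at hy)
  · have h' := key (-y) (by linarith) (by rwa [abs_of_neg h] at hy)
    have e1 : Real.sin (-y / 2) ^ 2 = Real.sin (y / 2) ^ 2 := by
      rw [show -y / 2 = -(y / 2) by ring, Real.sin_neg]; ring
    have e2 : (-y) ^ 2 - (-y) ^ 4 / 12 = y ^ 2 - y ^ 4 / 12 := by ring
    rw [e1, e2] at h'
    exact h'

/-- `π² < 12`. [folklore] -/
theorem pi_sq_lt_twelve : Real.pi ^ 2 < 12 := by
  have h1 := Real.pi_lt_d2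
  have h2 := Real.pi_pos
  nlinarith

/-- `0 ≤ 1 − y²/12` for `|y| ≤ π`. [folklore] -/
theorem one_sub_sq_div_twelve_nonneg (y : ℝ) (hy : |y| ≤ Real.pi) : 0 ≤ 1 - y ^ 2 / 12 := by
  have hy2 : y ^ 2 ≤ Real.pi ^ 2 := by
    rw [← sq_abs y]
    exact pow_le_pow_left₀ (abs_nonneg y) hy 2
  have := pi_sq_lt_twelve
  linarith

/-- the unshifted averaging factor `ρ_n(y) = S₁(y)/S_ξ(y) = |v(y)|² ≥ 1 − y²/12` on `|y| ≤ π`, every `n ≥ 1`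
(`S₁(y) ≥ y² − y⁴/12 = (1 − y²/12)·y² ≥ (1 − y²/12)·S_ξ(y)`). [folklore] -/
theorem uFactorr_zero_ge_taylor (n : ℕ) (hn : 1 ≤ n) (y : ℝ) (hy : |y| ≤ Real.pi) :
    1 - y ^ 2 / 12 ≤ uFactorr n 0 y := by
  unfold uFactorr
  simp only [if_true]
  by_cases h0 : y = 0
  · subst h0; simp
  · simp only [h0, if_false]
    have hpos : 0 < Sxir n y := Sxir_pos n hn y h0 hy
    rw [le_div_iff₀ hpos]
    have hc := one_sub_sq_div_twelve_nonneg y hy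
    calc (1 - y ^ 2 / 12) * Sxir n y ≤ (1 - y ^ 2 / 12) * y ^ 2 :=
          mul_le_mul_of_nonneg_left (Sxir_le n y) hc
      _ = y ^ 2 - y ^ 4 / 12 := by ring
      _ ≤ S1r y := S1r_ge_taylor y hy

/-- `|u(p′)|² = Π_μ ρ_n(p′_μ) ≥ 1 − Σ_μ p′_μ²/12` on the Brillouin zone, every `n ≥ 1` — the factorwise bound
`uFactorr_zero_ge_taylor` multiplied out by induction on the dimension (the Weierstrass step
`xP ≥ x + P − 1` for `x, P ∈ [0,1]`; the general Weierstrass product inequality is the tree's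
`Literature.NumberTheory.LFunctions.RobinOscillation.one_sub_sum_le_prod`, deliberately not imported into this B5 leaf).
[folklore] -/
theorem Ur_zero_ge_one_sub (n : ℕ) [NeZero n] (hn : 1 ≤ n) :
    ∀ (m : ℕ) (s : Fin m → ℝ), (∀ μ, |s μ| ≤ Real.pi) →
      1 - (∑ μ, s μ ^ 2) / 12 ≤ Ur n (fun _ => (0 : Fin n)) s := by
  intro m
  induction m with
  | zero => intro s _; simp [Ur]
  | succ m ih =>
    intro s hs
    have hρ0 : 1 - s 0 ^ 2 / 12 ≤ uFactorr n 0 (s 0) := uFactorr_zero_ge_taylor n hn (s 0) (hs 0)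
    have hP : 1 - (∑ μ : Fin m, s μ.succ ^ 2) / 12 ≤ Ur n (fun _ => (0 : Fin n)) (fun μ => s μ.succ) :=
      ih (fun μ => s μ.succ) (fun μ => hs μ.succ)
    have hP0 : 0 ≤ Ur n (fun _ => (0 : Fin n)) (fun μ => s μ.succ) := Ur_nonneg _ _ _
    have hP1 : Ur n (fun _ => (0 : Fin n)) (fun μ => s μ.succ) ≤ 1 := Ur_le_one n hn _ _
    have eU : Ur n (fun _ => (0 : Fin n)) s
        = uFactorr n 0 (s 0) * Ur n (fun _ => (0 : Fin n)) (fun μ => s μ.succ) := by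
      simp only [Ur, Fin.prod_univ_succ, Fin.val_zero]
    have eT : ∑ μ, s μ ^ 2 = s 0 ^ 2 + ∑ μ : Fin m, s μ.succ ^ 2 := Fin.sum_univ_succ _
    rw [eU, eT]
    have h1 : (1 - s 0 ^ 2 / 12) * Ur n (fun _ => (0 : Fin n)) (fun μ => s μ.succ)
        ≤ uFactorr n 0 (s 0) * Ur n (fun _ => (0 : Fin n)) (fun μ => s μ.succ) :=
      mul_le_mul_of_nonneg_right hρ0 hP0
    have h2 : 0 ≤ s 0 ^ 2 / 12 * (1 - Ur n (fun _ => (0 : Fin n)) (fun μ => s μ.succ)) :=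
      mul_nonneg (div_nonneg (sq_nonneg _) (by norm_num)) (sub_nonneg.mpr hP1)
    nlinarith [h1, h2, hP]

/-! ### §2 The lattice inequality `Δ₀|u|²/Δ + 2Δ₀ ≥ 1` -/

variable {m : ℕ}

/-- **THE KEY LATTICE INEQUALITY.**  On the punctured Brillouin zone `0 < max|p′_μ| ≤ π`, for every `n = L^k ≥ 1`:
`Δ₀(p′)|u(p′)|²/Δ(p′) + 2Δ₀(p′) ≥ 1`  (`Δ₀ = Σ_μ(2 − 2cos p′_μ)`, `Δ = Σ_μ n²(2 − 2cos(p′_μ/n))`, `|u(p′)|² = Π_μ ρ_n(p′_μ)`).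
Proof: with `T = Σ_μ p′_μ²`, `Δ₀ ≥ (1 − T/12)Δ` and `|u|² ≥ 1 − T/12` (§1), so for `T ≤ 6`
`Δ₀|u|²/Δ ≥ (1 − T/12)² ≥ 1 − T/6` while `2Δ₀ ≥ 8T/π² ≥ T/6`; for `T > 6`, `2Δ₀ ≥ 8T/π² > 48/π² > 1`. [folklore] -/
theorem key_lattice_ineq (n : ℕ) [NeZero n] (hn : 1 ≤ n) (s : Fin m → ℝ) (hs : ∀ μ, |s μ| ≤ Real.pi)
    (μ₀ : Fin m) (hμ₀ : s μ₀ ≠ 0) :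
    1 ≤ Delta1r 0 s * Ur n (fun _ => (0 : Fin n)) s / DeltaXir n 0 s + 2 * Delta1r 0 s := by
  have hD : 0 < DeltaXir n 0 s := DeltaXir_pos n hn s hs μ₀ hμ₀
  have hΔ0 : 0 ≤ Delta1r 0 s := Delta1r_nonneg 0 le_rfl s
  have hU0 : 0 ≤ Ur n (fun _ => (0 : Fin n)) s := Ur_nonneg _ _ _
  have hT0 : 0 ≤ ∑ μ, s μ ^ 2 := Finset.sum_nonneg (fun μ _ => sq_nonneg (s μ))
  have hsT : ∀ μ, s μ ^ 2 ≤ ∑ ν, s ν ^ 2 := fun μ =>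
    Finset.single_le_sum (f := fun ν => s ν ^ 2) (fun ν _ => sq_nonneg (s ν)) (Finset.mem_univ μ)
  -- (i) Δ₀ ≥ (1 − T/12)·Δ, termwise
  have h1 : (1 - (∑ μ, s μ ^ 2) / 12) * DeltaXir n 0 s ≤ Delta1r 0 s := by
    unfold DeltaXir Delta1r
    simp only [add_zero]
    rw [Finset.mul_sum]
    apply Finset.sum_le_sum
    intro μ _
    calc (1 - (∑ ν, s ν ^ 2) / 12) * Sxir n (s μ) ≤ (1 - s μ ^ 2 / 12) * Sxir n (s μ) := by
          apply mul_le_mul_of_nonneg_right _ (Sxir_nonneg n (s μ))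
          linarith [hsT μ]
      _ ≤ (1 - s μ ^ 2 / 12) * s μ ^ 2 :=
          mul_le_mul_of_nonneg_left (Sxir_le n (s μ)) (one_sub_sq_div_twelve_nonneg (s μ) (hs μ))
      _ = s μ ^ 2 - s μ ^ 4 / 12 := by ring
      _ ≤ S1r (s μ) := S1r_ge_taylor (s μ) (hs μ)
  -- (ii) |u(p′)|² ≥ 1 − T/12
  have h2 : 1 - (∑ μ, s μ ^ 2) / 12 ≤ Ur n (fun _ => (0 : Fin n)) s := Ur_zero_ge_one_sub n hn m s hs
  -- (iii) Jordan: 4T ≤ π² Δ₀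
  have h3 : 4 * (∑ μ, s μ ^ 2) / Real.pi ^ 2 ≤ Delta1r 0 s := by
    unfold Delta1r
    simp only [add_zero]
    have e : 4 * (∑ μ, s μ ^ 2) / Real.pi ^ 2 = ∑ μ, 4 * s μ ^ 2 / Real.pi ^ 2 := by
      rw [Finset.mul_sum, Finset.sum_div]
    rw [e]
    exact Finset.sum_le_sum (fun μ _ => S1r_ge (s μ) (hs μ))
  have hpi := pi_sq_lt_twelve
  have hpi0 : 0 < Real.pi ^ 2 := by positivity
  have h3' : 4 * (∑ μ, s μ ^ 2) ≤ Real.pi ^ 2 * Delta1r 0 s := by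
    have := (div_le_iff₀ hpi0).mp h3
    linarith
  have h3'' : 4 * (∑ μ, s μ ^ 2) ≤ 12 * Delta1r 0 s := by
    nlinarith [mul_nonneg (sub_nonneg.mpr hpi.le) hΔ0]
  rcases le_or_gt (∑ μ, s μ ^ 2) 6 with hT6 | hT6
  · -- small momenta: Δ₀|u|²/Δ ≥ (1 − T/12)² ≥ 1 − T/6 and 2Δ₀ ≥ T/6
    have hc : 0 ≤ 1 - (∑ μ, s μ ^ 2) / 12 := by linarith
    have h4 : (1 - (∑ μ, s μ ^ 2) / 12) * ((1 - (∑ μ, s μ ^ 2) / 12) * DeltaXir n 0 s)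
        ≤ Delta1r 0 s * Ur n (fun _ => (0 : Fin n)) s :=
      calc (1 - (∑ μ, s μ ^ 2) / 12) * ((1 - (∑ μ, s μ ^ 2) / 12) * DeltaXir n 0 s)
          ≤ Ur n (fun _ => (0 : Fin n)) s * ((1 - (∑ μ, s μ ^ 2) / 12) * DeltaXir n 0 s) :=
            mul_le_mul_of_nonneg_right h2 (mul_nonneg hc hD.le)
        _ ≤ Ur n (fun _ => (0 : Fin n)) s * Delta1r 0 s := mul_le_mul_of_nonneg_left h1 hU0
        _ = Delta1r 0 s * Ur n (fun _ => (0 : Fin n)) s := mul_comm _ _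
    have h5 : (1 - (∑ μ, s μ ^ 2) / 12) ^ 2 ≤ Delta1r 0 s * Ur n (fun _ => (0 : Fin n)) s / DeltaXir n 0 s := by
      rw [le_div_iff₀ hD]
      nlinarith [h4]
    have h6 : (∑ μ, s μ ^ 2) / 6 ≤ 2 * Delta1r 0 s := by linarith
    nlinarith [h5, h6, sq_nonneg (∑ μ, s μ ^ 2)]
  · -- large momenta: 2Δ₀ ≥ 8T/π² > 1
    have h6 : 1 ≤ 2 * Delta1r 0 s := by linarith
    have h7 : 0 ≤ Delta1r 0 s * Ur n (fun _ => (0 : Fin n)) s / DeltaXir n 0 s :=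
      div_nonneg (mul_nonneg hΔ0 hU0) hD.le
    linarith

/-! ### §3 The scalar heart -/

/-- **THE SCALAR HEART of «≦ a⁻²».**  For reals `0 < a ≤ 1`, `0 < Δ₀ ≤ Δ`, `U ≥ 0`, `ψ ≥ 0`, `χ` with `Δ₀χ ≤ ψ` and the
lattice inequality `Δ₀U/Δ + 2Δ₀ ≥ 1`:  `U + Δ²χ ≤ a⁻²(Δ + aU + aΔψ)²`.  (Read `U = |u(p′)|²`,
`ψ = Σ_{l≠0}|u(p′+l)|²/Δ(p′+l)`, `χ = Σ_{l≠0}|u(p′+l)|²/Δ(p′+l)²`: then `U + Δ²χ = 𝒩`, `Δ + aU + aΔψ = E`.)  With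
`w = U/Δ + ψ`: `Δ₀(U + Δ²χ) ≤ Δ²w`, `E = Δ(1 + aw)`, and `a²w ≤ a²Δ₀(1 + w)² ≤ Δ₀(1 + aw)²` because `Δ₀w + 2Δ₀ ≥ 1`
and `a ≤ 1`. [folklore] -/
theorem gamma1_scalar (a D Δ U ψ χ : ℝ) (ha0 : 0 < a) (ha1 : a ≤ 1) (hD : 0 < D) (hΔ : 0 < Δ)
    (hΔD : Δ ≤ D) (hU0 : 0 ≤ U) (hψ : 0 ≤ ψ) (hχψ : Δ * χ ≤ ψ) (hkey : 1 ≤ Δ * U / D + 2 * Δ) :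
    U + D ^ 2 * χ ≤ (a ^ 2)⁻¹ * (D + a * U + a * D * ψ) ^ 2 := by
  rw [← div_eq_inv_mul, le_div_iff₀ (pow_pos ha0 2)]
  have hD0 : D ≠ 0 := hD.ne'
  obtain ⟨u, hu0, rfl⟩ : ∃ u, 0 ≤ u ∧ U = u * D :=
    ⟨U / D, div_nonneg hU0 hD.le, by rw [div_mul_cancel₀ U hD0]⟩
  have hkey' : 1 ≤ Δ * u + 2 * Δ := by
    rw [mul_div_assoc, mul_div_cancel_right₀ u hD0] at hkey
    exact hkey
  have hw0 : 0 ≤ u + ψ := add_nonneg hu0 hψ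
  -- a²(u+ψ) ≤ Δ(1 + a(u+ψ))²
  have h4a : u + ψ ≤ Δ * (1 + (u + ψ)) ^ 2 := by
    have h : 1 ≤ Δ * (u + ψ) + 2 * Δ := by nlinarith [mul_nonneg hΔ.le hψ]
    nlinarith [mul_le_mul_of_nonneg_right h hw0, hΔ.le]
  have h4b : a ^ 2 * (1 + (u + ψ)) ^ 2 ≤ (1 + a * (u + ψ)) ^ 2 := by
    have h5 : a * (1 + (u + ψ)) ≤ 1 + a * (u + ψ) := by nlinarith
    have h6 : 0 ≤ a * (1 + (u + ψ)) := by positivity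
    have h7 := pow_le_pow_left₀ h6 h5 2
    calc a ^ 2 * (1 + (u + ψ)) ^ 2 = (a * (1 + (u + ψ))) ^ 2 := by ring
      _ ≤ (1 + a * (u + ψ)) ^ 2 := h7
  have h4 : a ^ 2 * (u + ψ) ≤ Δ * (1 + a * (u + ψ)) ^ 2 :=
    calc a ^ 2 * (u + ψ) ≤ a ^ 2 * (Δ * (1 + (u + ψ)) ^ 2) := mul_le_mul_of_nonneg_left h4a (sq_nonneg a)
      _ = Δ * (a ^ 2 * (1 + (u + ψ)) ^ 2) := by ring
      _ ≤ Δ * (1 + a * (u + ψ)) ^ 2 := mul_le_mul_of_nonneg_left h4b hΔ.le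
  -- Δ₀·𝒩 ≤ Δ²w
  have h1 : Δ * (u * D + D ^ 2 * χ) ≤ D ^ 2 * (u + ψ) := by
    have h1a : Δ * (u * D) ≤ D * (u * D) := mul_le_mul_of_nonneg_right hΔD (mul_nonneg hu0 hD.le)
    have h1b : D ^ 2 * (Δ * χ) ≤ D ^ 2 * ψ := mul_le_mul_of_nonneg_left hχψ (sq_nonneg D)
    nlinarith [h1a, h1b]
  -- E = Δ(1 + aw)
  have h2 : (D + a * (u * D) + a * D * ψ) ^ 2 = D ^ 2 * (1 + a * (u + ψ)) ^ 2 := by ring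
  rw [h2]
  have h3 : Δ * ((u * D + D ^ 2 * χ) * a ^ 2) ≤ Δ * (D ^ 2 * (1 + a * (u + ψ)) ^ 2) :=
    calc Δ * ((u * D + D ^ 2 * χ) * a ^ 2) = a ^ 2 * (Δ * (u * D + D ^ 2 * χ)) := by ring
      _ ≤ a ^ 2 * (D ^ 2 * (u + ψ)) := mul_le_mul_of_nonneg_left h1 (sq_nonneg a)
      _ = D ^ 2 * (a ^ 2 * (u + ψ)) := by ring
      _ ≤ D ^ 2 * (Δ * (1 + a * (u + ψ)) ^ 2) := mul_le_mul_of_nonneg_left h4 (sq_nonneg D)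
      _ = Δ * (D ^ 2 * (1 + a * (u + ψ)) ^ 2) := by ring
  exact le_of_mul_le_mul_left h3 hΔ

/-! ### §4 The spectral theorem `𝒩 ≤ a⁻²E²` on the Brillouin zone; the eigenvalues of `Q′G′²Q′*` -/

/-- at `p′ = 0` the regrouped numerator is `𝒩(0) = |u(0)|² = 1` (cf. `B5QGGQ145Torus.mReg_at_zero`). [folklore] -/
theorem Ncalr_zero (n : ℕ) [NeZero n] : Ncalr n (0 : Fin m → ℝ) = 1 := by
  classical
  have hD : DeltaXir n 0 (0 : Fin m → ℝ) = 0 := by simp [DeltaXir, Sxir]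
  have hU : Ur n (fun _ => (0 : Fin n)) (0 : Fin m → ℝ) = 1 := by simp [Ur, uFactorr]
  rw [Ncalr, hU, hD]
  simp

/-- at `p′ = 0` the regrouped denominator is `E(0) = a` (`Δ(0) = 0`, `|u(0)|² = 1`; cf. `B5QGGQ145Torus.mReg_at_zero`). [folklore] -/
theorem Er_zero (n : ℕ) [NeZero n] (a : ℝ) : Er n a 0 (0 : Fin m → ℝ) = a := by
  classical
  have hD : DeltaXir n 0 (0 : Fin m → ℝ) = 0 := by simp [DeltaXir, Sxir]
  have hU : Ur n (fun _ => (0 : Fin n)) (0 : Fin m → ℝ) = 1 := by simp [Ur, uFactorr]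
  rw [Er, hD, hU]
  simp

/-- **B5 p. 25 «0 < Q′_kG′_k²Q′_k* ≦ a⁻²», SPECTRALLY, for every `0 < a ≤ 1`**: on the whole Brillouin zone `[−π,π]^m`,
for every `m`, every `n = L^k ≥ 1`:  `𝒩(p′) ≤ a⁻² E(p′)²`, i.e. the multiplier (1.45) `= 𝒩/E²` is `≤ a⁻²`
(positivity `> 0` is `B5QGGQ145Torus.mRegr_pos`).  Equality holds at `p′ = 0` (`Ncalr_zero`, `Er_zero`).  The regime
`a ≤ 1` is essential for the printed constant: for large `a` it fails (G-B5-13, `B5.printed_gamma1_fails`).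
[cite: Balaban1984PropagatorsI, p.25 (after (1.44): «We have bounds 0 < Q′_kG′_k²Q′_k* ≦ a⁻²»); p.26 («γ₁ = a⁻²»)] -/
theorem Ncalr_le (n : ℕ) [NeZero n] (hn : 1 ≤ n) (a : ℝ) (ha0 : 0 < a) (ha1 : a ≤ 1) (s : Fin m → ℝ)
    (hs : ∀ μ, |s μ| ≤ Real.pi) : Ncalr n s ≤ (a ^ 2)⁻¹ * Er n a 0 s ^ 2 := by
  classical
  by_cases h0 : s = 0
  · subst h0
    rw [Ncalr_zero, Er_zero, inv_mul_cancel₀ (pow_ne_zero 2 ha0.ne')]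
  · obtain ⟨μ₀, hμ₀⟩ := Function.ne_iff.mp h0
    have hμ₀' : s μ₀ ≠ 0 := hμ₀
    have hD : 0 < DeltaXir n 0 s := DeltaXir_pos n hn s hs μ₀ hμ₀'
    have hΔ : 0 < Delta1r 0 s := Delta1r_pos s hs μ₀ hμ₀'
    have hΔD : Delta1r 0 s ≤ DeltaXir n 0 s := Delta1r_le_DeltaXir n hn s
    have hU0 : 0 ≤ Ur n (fun _ => (0 : Fin n)) s := Ur_nonneg _ _ _
    have hDk : ∀ k : Fin m → Fin n, 0 < DeltaXir n 0 (shiftr n k s) := fun k =>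
      hΔ.trans_le (Delta1r_le_DeltaXir_shift n hn k s)
    have hψ0 : 0 ≤ ∑ k ∈ Finset.univ.erase (fun _ => (0 : Fin n)), Ur n k s / DeltaXir n 0 (shiftr n k s) :=
      Finset.sum_nonneg (fun k _ => div_nonneg (Ur_nonneg _ _ _) (hDk k).le)
    -- Δ₀ χ ≤ ψ termwise, from Δ(p′+l) ≥ Δ₀(p′)
    have hχψ : Delta1r 0 s * Xner n s
        ≤ ∑ k ∈ Finset.univ.erase (fun _ => (0 : Fin n)), Ur n k s / DeltaXir n 0 (shiftr n k s) := by
      unfold Xner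
      rw [Finset.mul_sum]
      apply Finset.sum_le_sum
      intro k _
      have hk := hDk k
      have hle := Delta1r_le_DeltaXir_shift n hn k s
      have hUk := Ur_nonneg n k s
      have e : Delta1r 0 s * (Ur n k s / DeltaXir n 0 (shiftr n k s) ^ 2)
          = Delta1r 0 s / DeltaXir n 0 (shiftr n k s) * (Ur n k s / DeltaXir n 0 (shiftr n k s)) := by
        rw [div_mul_div_comm, ← pow_two, mul_div_assoc]
      rw [e]
      calc Delta1r 0 s / DeltaXir n 0 (shiftr n k s) * (Ur n k s / DeltaXir n 0 (shiftr n k s))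
          ≤ 1 * (Ur n k s / DeltaXir n 0 (shiftr n k s)) := by
            apply mul_le_mul_of_nonneg_right _ (div_nonneg hUk hk.le)
            rw [div_le_iff₀ hk, one_mul]
            exact hle
        _ = Ur n k s / DeltaXir n 0 (shiftr n k s) := one_mul _
    have hkey := key_lattice_ineq n hn s hs μ₀ hμ₀'
    -- E = Δ + a|u|² + aΔψ
    have hR : ∑ k ∈ Finset.univ.erase (fun _ => (0 : Fin n)),
          Ur n k s * (DeltaXir n 0 s / DeltaXir n 0 (shiftr n k s))
        = DeltaXir n 0 s * ∑ k ∈ Finset.univ.erase (fun _ => (0 : Fin n)), Ur n k s / DeltaXir n 0 (shiftr n k s) := by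
      rw [Finset.mul_sum]
      exact Finset.sum_congr rfl (fun k _ => by ring)
    have hEr : Er n a 0 s = DeltaXir n 0 s + a * Ur n (fun _ => (0 : Fin n)) s
        + a * DeltaXir n 0 s * ∑ k ∈ Finset.univ.erase (fun _ => (0 : Fin n)), Ur n k s / DeltaXir n 0 (shiftr n k s) := by
      unfold Er
      rw [hR]
      ring
    rw [hEr]
    unfold Ncalr
    exact gamma1_scalar a _ _ _ _ _ ha0 ha1 hD hΔ hΔD hU0 hψ0 hχψ hkey

variable {d : ℕ}

/-- **EVERY EIGENVALUE OF `Q′_kG′_k²Q′_k*` IS `≤ a⁻²`** (`0 < a ≤ 1`): on every torus `Π_μ ℤ/N_μ`, every `n = L^k ≥ 1`, at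
every dual momentum.  [cite: Balaban1984PropagatorsI, p.25 («We have bounds 0 < Q′_kG′_k²Q′_k* ≦ a⁻²»); p.26 («γ₁ = a⁻²»)] -/
theorem ev_le_inv_sq (n : ℕ) [NeZero n] (hn1 : 1 ≤ n) (a : ℝ) (ha0 : 0 < a) (ha1 : a ≤ 1)
    (N : Fin (d + 1) → ℕ) (k : (i : Fin (d + 1)) → Fin (N i)) : ev n a N k ≤ (a ^ 2)⁻¹ := by
  have hp := dualMomentum_mem_BZ N k
  have hs : ∀ μ, |dualMomentum N k μ| ≤ Real.pi := fun μ => abs_le.mpr ⟨hp.1 μ, hp.2 μ⟩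
  have hE : 0 < Er n a 0 (dualMomentum N k) := by
    have h1 : (0 : ℝ) < (4 / Real.pi ^ 2) ^ (d + 1) := by positivity
    exact (mul_pos ha0 h1).trans_le (Er_ge n hn1 a 0 ha0.le le_rfl _ hs)
  unfold ev
  rw [div_le_iff₀ (pow_pos hE 2)]
  exact Ncalr_le n hn1 a ha0 ha1 _ hs

/-- the dual momentum of the zero grid point is `p′ = 0`. [folklore] -/
theorem dualMomentum_eq_zero (N : Fin (d + 1) → ℕ) (k : (i : Fin (d + 1)) → Fin (N i))
    (hk : ∀ i, (k i : ℕ) = 0) : dualMomentum N k = 0 := by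
  have h0 : rep ((0 : ℝ) : UnitAddCircle) = 0 := rep_coe (by norm_num)
  funext i
  unfold dualMomentum MultiPeriod.gridPt
  rw [hk i, Nat.cast_zero, zero_div, h0, mul_zero]
  rfl

/-- **THE BOUND `a⁻²` IS ATTAINED**: at the zero momentum of any torus the eigenvalue of `Q′_kG′_k²Q′_k*` equals `a⁻²`
(`Q′G′²Q′*1 = a⁻²·1`; every `a`). [cite: Balaban1984PropagatorsI, p.25 («≦ a⁻²»), p.26 («γ₁ = a⁻²»)] -/
theorem ev_at_zero (n : ℕ) [NeZero n] (a : ℝ) (N : Fin (d + 1) → ℕ) (k : (i : Fin (d + 1)) → Fin (N i))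
    (hk : ∀ i, (k i : ℕ) = 0) : ev n a N k = (a ^ 2)⁻¹ := by
  unfold ev
  rw [dualMomentum_eq_zero N k hk, Ncalr_zero, Er_zero, one_div]

/-! ### §5 The complementary explicit constants: `E ≤ π²m + a(1 + π²m/4)`, `ev ≥ γ₀(d)` -/

/-- an explicit upper bound for the regrouped denominator on the Brillouin zone, every `n ≥ 1`, `a ≥ 0`:
`E(p′) ≤ π²m + a(1 + π²m/4)`  (`Δ ≤ (π²/4)Δ₀ ≤ π²m`, `|u(p′)|² ≤ 1`, `Σ_{l≠0}|u(p′+l)|²·Δ/Δ(p′+l) ≤ Δ/4` since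
`Δ(p′+l) ≥ 4` for `l ≠ 0` and `Σ_{l≠0}|u(p′+l)|² ≤ 1`). [folklore] -/
theorem Er_le (n : ℕ) [NeZero n] (hn : 1 ≤ n) (a : ℝ) (ha : 0 ≤ a) (s : Fin m → ℝ) (hs : ∀ μ, |s μ| ≤ Real.pi) :
    Er n a 0 s ≤ Real.pi ^ 2 * m + a * (1 + Real.pi ^ 2 * m / 4) := by
  have hD0 : 0 ≤ DeltaXir n 0 s := DeltaXir_nonneg n 0 le_rfl s
  have hD : DeltaXir n 0 s ≤ Real.pi ^ 2 * m := by
    have h1 := DeltaXir_le_Delta1r n s hs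
    have h2 := Delta1r_le s
    have hpi : 0 ≤ Real.pi ^ 2 / 4 := by positivity
    calc DeltaXir n 0 s ≤ Real.pi ^ 2 / 4 * Delta1r 0 s := h1
      _ ≤ Real.pi ^ 2 / 4 * (4 * m) := mul_le_mul_of_nonneg_left h2 hpi
      _ = Real.pi ^ 2 * m := by ring
  have hU : Ur n (fun _ => (0 : Fin n)) s ≤ 1 := Ur_le_one n hn _ s
  have hS : ∑ k ∈ Finset.univ.erase (fun _ => (0 : Fin n)),
        Ur n k s * (DeltaXir n 0 s / DeltaXir n 0 (shiftr n k s)) ≤ DeltaXir n 0 s / 4 := by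
    calc ∑ k ∈ Finset.univ.erase (fun _ => (0 : Fin n)), Ur n k s * (DeltaXir n 0 s / DeltaXir n 0 (shiftr n k s))
        ≤ ∑ k ∈ Finset.univ.erase (fun _ => (0 : Fin n)), Ur n k s * (DeltaXir n 0 s / 4) := by
          apply Finset.sum_le_sum
          intro k hk
          have hk0 : k ≠ fun _ => 0 := Finset.ne_of_mem_erase hk
          have h4 := DeltaXir_shift_ge_four n k hk0 s hs
          exact mul_le_mul_of_nonneg_left (div_le_div_of_nonneg_left hD0 (by norm_num) h4) (Ur_nonneg n k s)
      _ = (∑ k ∈ Finset.univ.erase (fun _ => (0 : Fin n)), Ur n k s) * (DeltaXir n 0 s / 4) := by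
          rw [Finset.sum_mul]
      _ ≤ 1 * (DeltaXir n 0 s / 4) :=
          mul_le_mul_of_nonneg_right (S0_le_one n hn s hs) (div_nonneg hD0 (by norm_num))
      _ = DeltaXir n 0 s / 4 := one_mul _
  unfold Er
  have h5 : a * Ur n (fun _ => (0 : Fin n)) s ≤ a * 1 := mul_le_mul_of_nonneg_left hU ha
  have h6 : a * ∑ k ∈ Finset.univ.erase (fun _ => (0 : Fin n)),
        Ur n k s * (DeltaXir n 0 s / DeltaXir n 0 (shiftr n k s)) ≤ a * (DeltaXir n 0 s / 4) :=
    mul_le_mul_of_nonneg_left hS ha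
  have h7 : a * (DeltaXir n 0 s / 4) ≤ a * (Real.pi ^ 2 * m / 4) :=
    mul_le_mul_of_nonneg_left (by linarith) ha
  linarith

/-- the explicit constant `γ₀(d) = (4/π²)^{d+1} / (π²(d+1) + (1 + π²(d+1)/4))²` is positive (no `def` is introduced:
the constant is written out in every statement, so that this leaf is a pure proof file). [folklore] -/
theorem gamma0_pos (d : ℕ) :
    (0 : ℝ) < (4 / Real.pi ^ 2) ^ (d + 1) / (Real.pi ^ 2 * (d + 1 : ℕ) + (1 + Real.pi ^ 2 * (d + 1 : ℕ) / 4)) ^ 2 := by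
  positivity

/-- **EVERY EIGENVALUE OF `Q′_kG′_k²Q′_k*` IS `≥ γ₀(d)`, AN EXPLICIT CONSTANT DEPENDING ON `d` ONLY**, for all
`0 < a ≤ 1`, on every torus, every `n = L^k ≥ 1`, at every dual momentum:
`γ₀(d) = (4/π²)^{d+1} / (π²(d+1) + (1 + π²(d+1)/4))²` (numerator from `B5Strip145.Ncalr_ge`, denominator from `Er_le` at
`a = 1`; far from optimal). [cite: Balaban1984PropagatorsI, p.26 («there are positive constants γ₀, γ₁, in fact γ₀ dependent
only on d … such that γ₀ ≦ Q′_kG′_k²Q′_k*»)] -/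
theorem gamma0_le_ev (n : ℕ) [NeZero n] (hn1 : 1 ≤ n) (a : ℝ) (ha0 : 0 < a) (ha1 : a ≤ 1)
    (N : Fin (d + 1) → ℕ) (k : (i : Fin (d + 1)) → Fin (N i)) :
    (4 / Real.pi ^ 2) ^ (d + 1) / (Real.pi ^ 2 * (d + 1 : ℕ) + (1 + Real.pi ^ 2 * (d + 1 : ℕ) / 4)) ^ 2 ≤ ev n a N k := by
  have hp := dualMomentum_mem_BZ N k
  have hs : ∀ μ, |dualMomentum N k μ| ≤ Real.pi := fun μ => abs_le.mpr ⟨hp.1 μ, hp.2 μ⟩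
  set B : ℝ := Real.pi ^ 2 * (d + 1 : ℕ) + (1 + Real.pi ^ 2 * (d + 1 : ℕ) / 4) with hB
  have hB0 : 0 < B := by rw [hB]; positivity
  have hElo : 0 < Er n a 0 (dualMomentum N k) := by
    have h1 : (0 : ℝ) < (4 / Real.pi ^ 2) ^ (d + 1) := by positivity
    exact (mul_pos ha0 h1).trans_le (Er_ge n hn1 a 0 ha0.le le_rfl _ hs)
  have hEhi : Er n a 0 (dualMomentum N k) ≤ B := by
    have h := Er_le n hn1 a ha0.le (dualMomentum N k) hs
    have h2 : a * (1 + Real.pi ^ 2 * (d + 1 : ℕ) / 4) ≤ 1 * (1 + Real.pi ^ 2 * (d + 1 : ℕ) / 4) :=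
      mul_le_mul_of_nonneg_right ha1 (by positivity)
    rw [hB]
    linarith
  have hN := Ncalr_ge n hn1 (dualMomentum N k) hs
  unfold ev
  calc (4 / Real.pi ^ 2) ^ (d + 1) / B ^ 2 ≤ (4 / Real.pi ^ 2) ^ (d + 1) / Er n a 0 (dualMomentum N k) ^ 2 := by
        apply div_le_div_of_nonneg_left (by positivity) (pow_pos hElo 2)
        exact pow_le_pow_left₀ hElo.le hEhi 2
    _ ≤ Ncalr n (dualMomentum N k) / Er n a 0 (dualMomentum N k) ^ 2 :=
        div_le_div_of_nonneg_right hN (pow_pos hElo 2).le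

/-! ### §6 The printed sentences as operator inequalities on every torus, `0 < a ≤ 1` -/

/-- **B5 p. 26, AS PRINTED, FOR `0 < a ≤ 1`: «there are positive constants γ₀, γ₁, in fact γ₀ dependent only on d,
γ₁ = a⁻², such that γ₀ ≦ Q′_kG′_k²Q′_k* ≦ γ₁»** — as operator inequalities on every finite torus `Π_μ ℤ/N_μ` (`N_μ ≥ 1`),
for every `n = L^k ≥ 1`, every `a ∈ (0,1]` and every `ω : T₁ → ℂ`:
`γ₀(d)·Σ_y|ω(y)|² ≤ Re⟨ω, Q′G′²Q′*ω⟩ ≤ a⁻²·Σ_y|ω(y)|²`, the form being real; `γ₀ = γ₀(d)` is chosen BEFORE `k`, the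
volume, `a` and `ω` (the quantifier shape of the skeleton's `B5.Bounds145Printed`).  HONEST SCOPE: `a ≤ 1` (for large `a`
the value γ₁ = a⁻² is false, G-B5-13). [cite: Balaban1984PropagatorsI, p.26 (the sentence after (1.45)); p.25 («We have
bounds 0 < Q′_kG′_k²Q′_k* ≦ a⁻²»)] -/
theorem printed_bounds_small_a (d : ℕ) :
    ∃ γ₀ : ℝ, 0 < γ₀ ∧ ∀ (n : ℕ) [NeZero n], 1 ≤ n → ∀ a : ℝ, 0 < a → a ≤ 1 →
      ∀ (N : Fin (d + 1) → ℕ), (∀ i, 1 ≤ N i) → ∀ ω : (Fin (d + 1) → ℤ) → ℂ,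
        γ₀ * ∑ y ∈ box N, ‖ω y‖ ^ 2 ≤ (∑ y ∈ box N, ∑ y' ∈ box N, conj (ω y) * qggq n a 0 N y y' * ω y').re ∧
        (∑ y ∈ box N, ∑ y' ∈ box N, conj (ω y) * qggq n a 0 N y y' * ω y').re ≤ (a ^ 2)⁻¹ * ∑ y ∈ box N, ‖ω y‖ ^ 2 ∧
        (∑ y ∈ box N, ∑ y' ∈ box N, conj (ω y) * qggq n a 0 N y y' * ω y').im = 0 := by
  refine ⟨_, gamma0_pos d, fun n _ hn1 a ha0 ha1 N hN ω => ?_⟩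
  obtain ⟨h1, h2⟩ := form_qggq_bounds n hn1 a hN (fun k => gamma0_le_ev n hn1 a ha0 ha1 N k)
    (fun k => ev_le_inv_sq n hn1 a ha0 ha1 N k) ω
  exact ⟨h1, h2, form_qggq_im n hn1 a hN ω⟩

/-- **B5 p. 25, «they imply the existence of the inverse operator and a bound from below», FOR `0 < a ≤ 1`, WITH THE BOUND
FROM BELOW `= a²`**: the operator with kernel `torusKernel145M` (= `(Q′_kG′_k²Q′_k*)⁻¹` on the torus,
`B5QGGQ145Torus.torusKernel145M_conv_qggq`) satisfies, for every `n = L^k ≥ 1`, `a ∈ (0,1]`, torus and `ω`: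
`a²·Σ_y|ω(y)|² ≤ Re⟨ω, (Q′G′²Q′*)⁻¹ω⟩ ≤ γ₀(d)⁻¹·Σ_y|ω(y)|²`, the form being real. [cite: Balaban1984PropagatorsI, p.25
(the sentence «We have bounds 0 < Q′_kG′_k²Q′_k* ≦ a⁻², and they imply the existence of the inverse operator and a bound
from below»)] -/
theorem printed_inverse_bounds_small_a (d : ℕ) :
    ∃ γ₀ : ℝ, 0 < γ₀ ∧ ∀ (n : ℕ) [NeZero n], 1 ≤ n → ∀ a : ℝ, 0 < a → a ≤ 1 →
      ∀ (N : Fin (d + 1) → ℕ), (∀ i, 1 ≤ N i) → ∀ ω : (Fin (d + 1) → ℤ) → ℂ,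
        a ^ 2 * ∑ y ∈ box N, ‖ω y‖ ^ 2
          ≤ (∑ y ∈ box N, ∑ y' ∈ box N, conj (ω y) * torusKernel145M n a N (y - y') * ω y').re ∧
        (∑ y ∈ box N, ∑ y' ∈ box N, conj (ω y) * torusKernel145M n a N (y - y') * ω y').re
          ≤ γ₀⁻¹ * ∑ y ∈ box N, ‖ω y‖ ^ 2 ∧
        (∑ y ∈ box N, ∑ y' ∈ box N, conj (ω y) * torusKernel145M n a N (y - y') * ω y').im = 0 := by
  refine ⟨_, gamma0_pos d, fun n _ hn1 a ha0 ha1 N hN ω => ?_⟩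
  have hP : 0 ≤ (∏ i, ((N i : ℕ) : ℝ))⁻¹ := inv_nonneg.mpr (Finset.prod_nonneg fun i _ => Nat.cast_nonneg _)
  have hlo : ∀ k : (i : Fin (d + 1)) → Fin (N i), a ^ 2 ≤ (ev n a N k)⁻¹ := fun k => by
    have h := ev_le_inv_sq n hn1 a ha0 ha1 N k
    have h2 := inv_anti₀ (ev_pos n hn1 a ha0 N k) h
    rwa [inv_inv] at h2
  have hhi : ∀ k : (i : Fin (d + 1)) → Fin (N i), (ev n a N k)⁻¹
      ≤ ((4 / Real.pi ^ 2) ^ (d + 1) / (Real.pi ^ 2 * (d + 1 : ℕ) + (1 + Real.pi ^ 2 * (d + 1 : ℕ) / 4)) ^ 2)⁻¹ := fun k =>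
    inv_anti₀ (gamma0_pos d) (gamma0_le_ev n hn1 a ha0 ha1 N k)
  obtain ⟨h1, h2⟩ := weighted_sum_bounds (fun k => (ev n a N k)⁻¹) (fun k => ‖dft N ω k‖ ^ 2)
    (fun k => sq_nonneg _) hlo hhi
  refine ⟨?_, ?_, form_inverse_im n a N ω⟩
  · rw [form_inverse_re, plancherel_box_real hN]
    calc a ^ 2 * ((∏ i, ((N i : ℕ) : ℝ))⁻¹ * ∑ k, ‖dft N ω k‖ ^ 2)
        = (∏ i, ((N i : ℕ) : ℝ))⁻¹ * (a ^ 2 * ∑ k, ‖dft N ω k‖ ^ 2) := by ring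
      _ ≤ (∏ i, ((N i : ℕ) : ℝ))⁻¹ * ∑ k, (ev n a N k)⁻¹ * ‖dft N ω k‖ ^ 2 := mul_le_mul_of_nonneg_left h1 hP
  · rw [form_inverse_re, plancherel_box_real hN]
    calc (∏ i, ((N i : ℕ) : ℝ))⁻¹ * ∑ k, (ev n a N k)⁻¹ * ‖dft N ω k‖ ^ 2
        ≤ (∏ i, ((N i : ℕ) : ℝ))⁻¹ * (((4 / Real.pi ^ 2) ^ (d + 1) / (Real.pi ^ 2 * (d + 1 : ℕ) + (1 + Real.pi ^ 2 * (d + 1 : ℕ) / 4)) ^ 2)⁻¹ * ∑ k, ‖dft N ω k‖ ^ 2) :=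
          mul_le_mul_of_nonneg_left h2 hP
      _ = ((4 / Real.pi ^ 2) ^ (d + 1) / (Real.pi ^ 2 * (d + 1 : ℕ) + (1 + Real.pi ^ 2 * (d + 1 : ℕ) / 4)) ^ 2)⁻¹
            * ((∏ i, ((N i : ℕ) : ℝ))⁻¹ * ∑ k, ‖dft N ω k‖ ^ 2) := by ring

end

end Literature.MathematicalPhysics.QuantumFieldTheory.Balaban1983to89.B5QGGQ145Gamma1
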